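import Literature.Geometry.Lorentzian.ADMTailClassInhabited
import Literature.Geometry.Lorentzian.SchwarzschildStaticChart
import Mathlib.Analysis.Calculus.MeanValue
import HarnessLib

/-!
# The exact Schwarzschild exterior in areal gauge inhabits `𝒞𝒮♯_{-τ}`, `τ ≤ 1` (Ellithy 2026, Remark 4.6)

A. Ellithy, *The spacetime Penrose inequality under a quasi final state hypothesis*, arXiv:2605.18730
(2026), Remark 4.6 (p. 40): "the stationary Kerr and Schwarzschild exteriors are compatible with the
final-state hypotheses after [a] harmless late-time gauge adjustment"; Definitions 3.6 (p. 21), 3.8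
(p. 22), 4.4 (p. 39), §4.1 (p. 38).

`ADMTailClassInhabited` (§11) puts the FIRST-ORDER truncation `N = 1 - m/r`, `λ = 1 + m/r` of the
Schwarzschild tail in the classes.  This module treats the EXACT static slices of the Schwarzschild
exterior of mass `m` in the areal (curvature-coordinate) gauge,
`g = -(1 - 2m/r) dt² + (1 - 2m/r)⁻¹ dr² + r² γ_{S²}`, i.e. the tuple
`(N, λ, β, b, γ) = ((1 - 2m/r)^{1/2}, (1 - 2m/r)^{-1/2}, 0, 0, r² γ_{S²})` (`schwarzschildAreal m`), on tails
`r > r₀ ≥ 4|m|`, `r₀ > 0`: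

* `schwarzschildAreal_isSharpTailCoeff` — `schwarzschildAreal m ∈ 𝒞𝒮♯_{-τ}(ℳ_{T̲,r₀})` for every
  `0 < α ≤ 2`, `τ ≤ 1`, `T̲` (via the generic profile lemma `radial_isSharpTailCoeff_of_profile`: the
  radial derivatives of `(1 - 2m/r)^p` are finite sums `∑ c r^κ (1 - 2m/r)^q` with `κ ≤ -(ℓ+1)`,
  `schwPow_iteratedDeriv_eq`, whence the weighted bounds `|r^{τ+ℓ} ∂_r^ℓ((1-2m/r)^p - 1)| ≤ B`);
* `schwarzschildAreal_restFrameTuple` — with the rest-frame clause of §4.1 (zero momentum flux), in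
  the window `α ∈ (0,1)`, `τ ∈ (1/2, 1)` of Def. 4.4.

* `radial_isGaugeReducible`, `radial_hasLateForcingDecay` — every static spherically symmetric tuple
  `radial f g` of the strengthened class is late-time gauge reducible (`β^⊥ = 0`, Def. 3.29) and
  satisfies the late forcing decay (A1) ∧ (A2) (`K_t ≡ 0`, Def. 3.28); hence
  `schwarzschildAreal_isGaugeReducible`, `schwarzschildAreal_hasLateForcingDecay`;
* `schwarzschildStaticForm m (t, y) := (schwarzschildAreal m).admForm t y` — the static Schwarzschild
  metric in Cartesian slice coordinates, `-(1 - 2m/r) dt² + dy² + (2m/(r - 2m)) dr²`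
  (`schwarzschildStaticForm_apply`), equal through `(t, y) ↦ (t, y⁰, y¹, y²)` to the tree's
  `Schwarzschild.staticBilin m` of `SchwarzschildStaticChart` (`schwarzschildStaticForm_eq_staticBilin`;
  Griffiths–Podolský 2009, (8.1)); and `schwarzschildStatic_isQuasiFinalAnalytic` — the Cartesian MODEL
  `(ℝ × E3, g_static)` with the polar late chart `Φ(t, r, p) = (t, r p)` satisfies the typed analytic
  predicate `IsQuasiFinalAnalytic` of Def. 4.4 (1)+(2)+§4.1 for every `r₀ > 0`, `r₀ ≥ 4|m|`, `T̲`: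
  non-vacuity of the D37′ analytic clauses AT POSITIVE MASS (the flat case is
  `minkowski_isQuasiFinalAnalytic`);
* the COLLAR SENTENCE of Def. 4.4 (1) for the same model: `schwarzschildStaticField m y` — the static
  form as an explicit field `η + (2m/|y|) dt² + (2m/((|y| - 2m)|y|²)) ⟪y, dy⟫²`, `C^∞` on `|y| > r₀/2`
  (`contDiffOn_schwarzschildStaticField`), uniformly nondegenerate (`‖G'(y) v‖ ≥ ‖v‖/3` for
  `|y| ≥ 3|m|`, `norm_le_norm_schwarzschildStaticField`) — `schwarzschildStatic_hasUniformCollarControl`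
  (`HasUniformCollarControl`: width `r₀/4`, derivative bounds by compactness of the closed collar) and
  `schwarzschildStatic_isQuasiFinalAnalyticCollar` (`IsQuasiFinalAnalyticCollar`, the positive-mass
  counterpart of `minkowski_isQuasiFinalAnalyticCollar`).

Model level (the vector space `ℝ × E3` with the static form, junk inside `r ≤ 2m`); the same statement on
the manifold `Kerr.exterior m 0` with `Schwarzschild.staticMetric` (an honest Lorentzian metric under the
prelude's `[Kerr.Facts]`), or on a Cauchy development, is not addressed here.  Typing a model proves
nothing about any summit; no facts are introduced.

## References

* [Ellithy2026] A. Ellithy, arXiv:2605.18730 (2026), Remark 4.6 (p. 40); Defs. 3.6, 3.8 (pp. 21–22),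
  3.28, 3.29 (p. 34), 4.4 (p. 39).
* [GriffithsPodolsky2009] J. B. Griffiths, J. Podolský, *Exact space-times in Einstein's general
  relativity*, CUP 2009, §8.1, (8.1).
-/

noncomputable section

-- bilinear-form-valued (`(ℝ × E3) →L[ℝ] (ℝ × E3) →L[ℝ] ℝ`) `smul`/`add` lemmas need one more pending-instance
-- level to synthesise (as in `ADMTailClassInhabited`); elaboration option only, no semantic effect.
set_option maxSynthPendingDepth 3

open Set Metric Function Filter MeasureTheory
open scoped ENNReal NNReal Topology Manifold RealInnerProductSpace
open Literature.Geometry.Lorentzian Literature.Geometry.Lorentzian.TailClassModel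

namespace Literature.Geometry.Lorentzian.TailClassModel

/-! ### The profiles `(1 - 2m/r)^p` and the algebra of their radial derivatives -/

section SchwPow

variable (m : ℝ)

/-- `(1 - 2m/r)^p` — the lapse (`p = 1/2`) and radial coefficient (`p = -1/2`) of the Schwarzschild
exterior in areal gauge. [cite: Ellithy2026, Remark 4.6, p. 40] -/
def schwPow (p : ℝ) (r : ℝ) : ℝ := (1 - 2 * m * r⁻¹) ^ p

/-- A monomial `c · r^κ · (1 - 2m/r)^q` of the derivative algebra (coefficient, `r`-exponent,
`(1-2m/r)`-exponent). [folklore] -/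
def schwTerm (t : ℝ × ℝ × ℝ) (r : ℝ) : ℝ := t.1 * (r ^ t.2.1 * schwPow m t.2.2 r)

/-- A finite sum of monomials. [folklore] -/
def schwSum (L : List (ℝ × ℝ × ℝ)) (r : ℝ) : ℝ := (L.map fun t ↦ schwTerm m t r).sum

/-- The derivative of a monomial: `d/dr [c r^κ w_q] = c κ r^{κ-1} w_q + 2 m q c r^{κ-2} w_{q-1}`.
[folklore] -/
def schwD (t : ℝ × ℝ × ℝ) : List (ℝ × ℝ × ℝ) :=
  [(t.1 * t.2.1, t.2.1 - 1, t.2.2), (2 * m * t.2.2 * t.1, t.2.1 - 2, t.2.2 - 1)]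

/-- The derivative of a finite sum of monomials (as a list). [folklore] -/
def schwDList (L : List (ℝ × ℝ × ℝ)) : List (ℝ × ℝ × ℝ) := L.flatMap (schwD m)

variable {m}

/-- The empty sum. [folklore] -/
@[simp] private theorem schwSum_nil (r : ℝ) : schwSum m [] r = 0 := by simp [schwSum]

/-- Sum of a cons. [folklore] -/
@[simp] private theorem schwSum_cons (t : ℝ × ℝ × ℝ) (L : List (ℝ × ℝ × ℝ)) (r : ℝ) :
    schwSum m (t :: L) r = schwTerm m t r + schwSum m L r := by simp [schwSum]

/-- Sum of an append. [folklore] -/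
private theorem schwSum_append (L L' : List (ℝ × ℝ × ℝ)) (r : ℝ) :
    schwSum m (L ++ L') r = schwSum m L r + schwSum m L' r := by simp [schwSum]

variable {r₀ : ℝ}

/-- On `r > r₀ ≥ 4|m|`, `r₀ > 0`: `1/2 ≤ 1 - 2m/r ≤ 3/2`. [folklore] -/
private theorem schwBase_bounds (hr₀ : 0 < r₀) (hm : 4 * |m| ≤ r₀) {r : ℝ} (hr : r₀ < r) :
    1 / 2 ≤ 1 - 2 * m * r⁻¹ ∧ 1 - 2 * m * r⁻¹ ≤ 3 / 2 := by
  have hr0 : 0 < r := hr₀.trans hr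
  have h : |2 * m * r⁻¹| ≤ 1 / 2 := by
    rw [abs_mul, abs_inv, abs_of_pos hr0, abs_mul, abs_two, ← div_eq_mul_inv, div_le_iff₀ hr0]
    nlinarith [abs_nonneg m]
  obtain ⟨h1, h2⟩ := abs_le.mp h
  constructor <;> linarith

/-- On the tail `1 - 2m/r > 0`. [folklore] -/
private theorem schwBase_pos (hr₀ : 0 < r₀) (hm : 4 * |m| ≤ r₀) {r : ℝ} (hr : r₀ < r) :
    0 < 1 - 2 * m * r⁻¹ := by
  linarith [(schwBase_bounds hr₀ hm hr).1]

/-- `d/dr (1 - 2m/r)^q = 2 m q r^{-2} (1 - 2m/r)^{q-1}` on the tail. [folklore] -/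
private theorem hasDerivAt_schwPow (hr₀ : 0 < r₀) (hm : 4 * |m| ≤ r₀) (q : ℝ) {r : ℝ} (hr : r₀ < r) :
    HasDerivAt (schwPow m q) (2 * m * q * r ^ (-2 : ℝ) * schwPow m (q - 1) r) r := by
  have hr0 : 0 < r := hr₀.trans hr
  have hb : 0 < 1 - 2 * m * r⁻¹ := schwBase_pos hr₀ hm hr
  have h1 : HasDerivAt (fun ρ : ℝ ↦ 1 - 2 * m * ρ⁻¹) (-(2 * m * -(r ^ 2)⁻¹)) r :=
    ((hasDerivAt_inv hr0.ne').const_mul (2 * m)).const_sub 1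
  have h2 : HasDerivAt (fun b : ℝ ↦ b ^ q) (q * (1 - 2 * m * r⁻¹) ^ (q - 1)) (1 - 2 * m * r⁻¹) :=
    Real.hasDerivAt_rpow_const (Or.inl hb.ne')
  have h := h2.comp r h1
  have hfun : ((fun b : ℝ ↦ b ^ q) ∘ fun ρ : ℝ ↦ 1 - 2 * m * ρ⁻¹) = schwPow m q := by
    funext ρ; simp [schwPow]
  rw [hfun] at h
  refine h.congr_deriv ?_
  have e : r ^ (-2 : ℝ) = (r ^ 2)⁻¹ := by
    rw [Real.rpow_neg hr0.le, Real.rpow_two]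
  rw [e, schwPow]
  ring

/-- `d/dr [c r^κ (1-2m/r)^q] = schwSum (schwD (c, κ, q))` on the tail. [folklore] -/
private theorem hasDerivAt_schwTerm (hr₀ : 0 < r₀) (hm : 4 * |m| ≤ r₀) (t : ℝ × ℝ × ℝ) {r : ℝ}
    (hr : r₀ < r) : HasDerivAt (schwTerm m t) (schwSum m (schwD m t) r) r := by
  obtain ⟨c, κ, q⟩ := t
  have hr0 : 0 < r := hr₀.trans hr
  have hκ : HasDerivAt (fun ρ : ℝ ↦ ρ ^ κ) (κ * r ^ (κ - 1)) r :=
    Real.hasDerivAt_rpow_const (Or.inl hr0.ne')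
  have h := ((hκ.mul (hasDerivAt_schwPow hr₀ hm q hr)).const_mul c)
  have hfun : schwTerm m (c, κ, q) = fun y ↦ c * ((fun ρ : ℝ ↦ ρ ^ κ) * schwPow m q) y := by
    funext y; simp [schwTerm]
  rw [hfun]
  refine h.congr_deriv ?_
  have e : r ^ (κ - 2) = r ^ κ * r ^ (-2 : ℝ) := by
    rw [← Real.rpow_add hr0, ← sub_eq_add_neg]
  simp only [schwSum, schwD, schwTerm, List.map_cons, List.map_nil, List.sum_cons, List.sum_nil,
    add_zero]
  rw [e]
  ring

/-- The derivative of a finite sum of monomials is the sum over the derived list. [folklore] -/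
private theorem hasDerivAt_schwSum (hr₀ : 0 < r₀) (hm : 4 * |m| ≤ r₀) (L : List (ℝ × ℝ × ℝ)) {r : ℝ}
    (hr : r₀ < r) : HasDerivAt (schwSum m L) (schwSum m (schwDList m L) r) r := by
  induction L with
  | nil =>
    have hfun : schwSum m [] = fun _ ↦ (0 : ℝ) := funext schwSum_nil
    have hval : schwSum m (schwDList m []) r = 0 := by simp [schwDList]
    rw [hfun, hval]
    exact hasDerivAt_const r (0 : ℝ)
  | cons t L ih =>
    have hfun : schwSum m (t :: L) = fun ρ ↦ schwTerm m t ρ + schwSum m L ρ := funext (schwSum_cons t L)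
    have hval : schwSum m (schwDList m (t :: L)) r =
        schwSum m (schwD m t) r + schwSum m (schwDList m L) r := by
      simp only [schwDList, List.flatMap_cons]
      exact schwSum_append _ _ r
    rw [hfun, hval]
    exact (hasDerivAt_schwTerm hr₀ hm t hr).add ih

/-- Every `r`-exponent in the derived list drops by at least one. [folklore] -/
private theorem schwDList_exponent_le {L : List (ℝ × ℝ × ℝ)} {e : ℝ} (hL : ∀ t ∈ L, t.2.1 ≤ e) :
    ∀ t ∈ schwDList m L, t.2.1 ≤ e - 1 := by
  intro t ht
  simp only [schwDList, List.mem_flatMap] at ht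
  obtain ⟨s, hs, hts⟩ := ht
  simp only [schwD, List.mem_cons, List.mem_nil_iff, or_false] at hts
  have hse := hL s hs
  rcases hts with rfl | rfl
  · simp only; linarith
  · simp only; linarith

/-- Iterating: after `n` derivations every exponent is `≤ e - n`. [folklore] -/
private theorem schwDList_iterate_exponent_le {L : List (ℝ × ℝ × ℝ)} {e : ℝ} (hL : ∀ t ∈ L, t.2.1 ≤ e)
    (n : ℕ) : ∀ t ∈ (schwDList m)^[n] L, t.2.1 ≤ e - n := by
  induction n with
  | zero => simpa using hL
  | succ n ih =>
    intro t ht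
    rw [Function.iterate_succ_apply'] at ht
    have := schwDList_exponent_le ih t ht
    push_cast
    linarith

/-- **Structure of the radial derivatives of `(1 - 2m/r)^p`**: on the tail `r > r₀ ≥ 4|m|`, `r₀ > 0`,
for `ℓ ≥ 1`, `∂_r^ℓ (1 - 2m/r)^p = schwSum (schwDList^[ℓ-1] [(2mp, -2, p-1)])`, a finite sum of monomials
`c r^κ (1-2m/r)^q` with `κ ≤ -(ℓ+1)`. [cite: Ellithy2026, Remark 4.6, p. 40] -/
theorem schwPow_iteratedDeriv_succ_eq (hr₀ : 0 < r₀) (hm : 4 * |m| ≤ r₀) (p : ℝ) (n : ℕ) {r : ℝ}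
    (hr : r₀ < r) :
    iteratedDeriv (n + 1) (schwPow m p) r =
      schwSum m ((schwDList m)^[n] [(2 * m * p, -2, p - 1)]) r := by
  induction n generalizing r with
  | zero =>
    rw [Function.iterate_zero_apply, iteratedDeriv_one, (hasDerivAt_schwPow hr₀ hm p hr).deriv]
    simp [schwSum, schwTerm]; ring
  | succ n ih =>
    rw [iteratedDeriv_succ, Function.iterate_succ_apply']
    have hev : iteratedDeriv (n + 1) (schwPow m p) =ᶠ[𝓝 r]
        schwSum m ((schwDList m)^[n] [(2 * m * p, -2, p - 1)]) :=
      Filter.eventuallyEq_of_mem (isOpen_Ioi.mem_nhds hr) fun ρ hρ ↦ ih hρ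
    rw [hev.deriv_eq, (hasDerivAt_schwSum hr₀ hm _ hr).deriv]

/-- The radial derivatives of order `≥ 1` of `(1 - 2m/r)^p - 1` and of `(1 - 2m/r)^p` agree. [folklore] -/
private theorem iteratedDeriv_succ_schwPow_sub_one (p : ℝ) (n : ℕ) :
    iteratedDeriv (n + 1) (fun ρ ↦ schwPow m p ρ - 1) = iteratedDeriv (n + 1) (schwPow m p) := by
  rw [iteratedDeriv_succ', iteratedDeriv_succ']
  congr 1
  funext ρ
  exact deriv_sub_const 1


/-! ### Bounds on the tail `r > r₀ ≥ 4|m|` -/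

/-- `max((1/2)^q, (3/2)^q)`, a bound for `b^q`, `b ∈ [1/2, 3/2]`. [folklore] -/
def schwCq (q : ℝ) : ℝ := max ((1 / 2 : ℝ) ^ q) ((3 / 2 : ℝ) ^ q)

/-- `schwCq q ≥ 0`. [folklore] -/
private theorem schwCq_nonneg (q : ℝ) : 0 ≤ schwCq q :=
  le_max_of_le_left (Real.rpow_nonneg (by norm_num) q)

/-- `b^q ≤ max((1/2)^q, (3/2)^q)` for `b ∈ [1/2, 3/2]`. [folklore] -/
private theorem rpow_le_schwCq {b : ℝ} (hb1 : 1 / 2 ≤ b) (hb2 : b ≤ 3 / 2) (q : ℝ) : b ^ q ≤ schwCq q := by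
  have hb0 : 0 < b := by linarith
  rcases le_or_gt 0 q with hq | hq
  · exact le_max_of_le_right (Real.rpow_le_rpow hb0.le hb2 hq)
  · exact le_max_of_le_left (Real.rpow_le_rpow_of_nonpos (by norm_num) hb1 hq.le)

/-- `|(1 - 2m/r)^q| ≤ schwCq q` on the tail. [folklore] -/
private theorem abs_schwPow_le (hr₀ : 0 < r₀) (hm : 4 * |m| ≤ r₀) (q : ℝ) {r : ℝ} (hr : r₀ < r) :
    |schwPow m q r| ≤ schwCq q := by
  obtain ⟨hb1, hb2⟩ := schwBase_bounds hr₀ hm hr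
  rw [schwPow, abs_of_pos (Real.rpow_pos_of_pos (schwBase_pos hr₀ hm hr) q)]
  exact rpow_le_schwCq hb1 hb2 q

/-- Weighted bound of one monomial: `|r^θ · c r^κ w_q| ≤ |c| schwCq(q) r₀^{θ+κ}` when `θ + κ ≤ 0`.
[folklore] -/
private theorem abs_rpow_mul_schwTerm_le (hr₀ : 0 < r₀) (hm : 4 * |m| ≤ r₀) {θ : ℝ} (t : ℝ × ℝ × ℝ)
    (hθ : θ + t.2.1 ≤ 0) {r : ℝ} (hr : r₀ < r) :
    |r ^ θ * schwTerm m t r| ≤ |t.1| * schwCq t.2.2 * r₀ ^ (θ + t.2.1) := by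
  obtain ⟨c, κ, q⟩ := t
  have hr0 : 0 < r := hr₀.trans hr
  simp only at hθ ⊢
  have e : r ^ θ * schwTerm m (c, κ, q) r = c * (r ^ (θ + κ) * schwPow m q r) := by
    rw [schwTerm, Real.rpow_add hr0]; ring
  rw [e, abs_mul, abs_mul, abs_of_pos (Real.rpow_pos_of_pos hr0 _), mul_assoc]
  refine mul_le_mul_of_nonneg_left ?_ (abs_nonneg c)
  rw [mul_comm]
  exact mul_le_mul (abs_schwPow_le hr₀ hm q hr) (Real.rpow_le_rpow_of_nonpos hr₀ hr.le hθ)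
    (Real.rpow_nonneg hr0.le _) (schwCq_nonneg q)

/-- Weighted bound of a finite sum of monomials whose exponents satisfy `θ + κ ≤ 0`. [folklore] -/
private theorem abs_rpow_mul_schwSum_le (hr₀ : 0 < r₀) (hm : 4 * |m| ≤ r₀) {θ : ℝ}
    (L : List (ℝ × ℝ × ℝ)) (hL : ∀ t ∈ L, θ + t.2.1 ≤ 0) {r : ℝ} (hr : r₀ < r) :
    |r ^ θ * schwSum m L r| ≤ (L.map fun t ↦ |t.1| * schwCq t.2.2 * r₀ ^ (θ + t.2.1)).sum := by
  induction L with
  | nil => simp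
  | cons t L ih =>
    rw [schwSum_cons, mul_add, List.map_cons, List.sum_cons]
    refine (abs_add_le _ _).trans (add_le_add ?_ ?_)
    · exact abs_rpow_mul_schwTerm_le hr₀ hm t (hL t (List.mem_cons_self ..)) hr
    · exact ih fun s hs ↦ hL s (List.mem_cons_of_mem t hs)

/-- **Order zero**: `|r^τ ((1 - 2m/r)^p - 1)| ≤ 2|m| |p| schwCq(p-1) r₀^{τ-1}` on the tail, `τ ≤ 1` (mean
value theorem for `b ↦ b^p` on `[1/2, 3/2]`, `|b - 1| = 2|m|/r`). [cite: Ellithy2026, Remark 4.6, p. 40] -/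
theorem abs_rpow_mul_schwPow_sub_one_le (hr₀ : 0 < r₀) (hm : 4 * |m| ≤ r₀) {τ : ℝ} (hτ : τ ≤ 1)
    (p : ℝ) {r : ℝ} (hr : r₀ < r) :
    |r ^ τ * (schwPow m p r - 1)| ≤ 2 * |m| * (|p| * schwCq (p - 1)) * r₀ ^ (τ - 1) := by
  have hr0 : 0 < r := hr₀.trans hr
  obtain ⟨hb1, hb2⟩ := schwBase_bounds hr₀ hm hr
  set b := 1 - 2 * m * r⁻¹ with hb
  -- mean value theorem for `x ↦ x^p` on `[1/2, 3/2]`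
  have hmvt : ‖b ^ p - (1 : ℝ) ^ p‖ ≤ |p| * schwCq (p - 1) * ‖b - 1‖ := by
    refine (convex_Icc (1 / 2 : ℝ) (3 / 2)).norm_image_sub_le_of_norm_hasDerivWithin_le
      (f := fun x : ℝ ↦ x ^ p) (f' := fun x ↦ p * x ^ (p - 1)) (fun x hx ↦ ?_) (fun x hx ↦ ?_)
      ⟨by norm_num, by norm_num⟩ ⟨hb1, hb2⟩
    · exact (Real.hasDerivAt_rpow_const (Or.inl (by linarith [hx.1] : x ≠ 0))).hasDerivWithinAt
    · rw [Real.norm_eq_abs, abs_mul]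
      refine mul_le_mul_of_nonneg_left ?_ (abs_nonneg p)
      rw [abs_of_pos (Real.rpow_pos_of_pos (by linarith [hx.1]) _)]
      exact rpow_le_schwCq hx.1 hx.2 (p - 1)
  rw [Real.one_rpow, Real.norm_eq_abs, Real.norm_eq_abs] at hmvt
  have hb1' : |b - 1| = 2 * |m| * r⁻¹ := by
    rw [hb, show (1 : ℝ) - 2 * m * r⁻¹ - 1 = -(2 * m * r⁻¹) by ring, abs_neg, abs_mul, abs_mul,
      abs_two, abs_of_pos (inv_pos.mpr hr0)]
  rw [hb1'] at hmvt
  have hτ' : r ^ τ * r⁻¹ = r ^ (τ - 1) := by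
    rw [Real.rpow_sub_one hr0.ne', div_eq_mul_inv]
  have hrτ : r ^ (τ - 1) ≤ r₀ ^ (τ - 1) := Real.rpow_le_rpow_of_nonpos hr₀ hr.le (by linarith)
  have hK : 0 ≤ 2 * |m| * (|p| * schwCq (p - 1)) := by
    have := schwCq_nonneg (p - 1); positivity
  have hmvt' : |schwPow m p r - 1| ≤ |p| * schwCq (p - 1) * (2 * |m| * r⁻¹) := by
    rw [schwPow, ← hb]; exact hmvt
  rw [abs_mul, abs_of_pos (Real.rpow_pos_of_pos hr0 τ)]
  calc r ^ τ * |schwPow m p r - 1| ≤ r ^ τ * (|p| * schwCq (p - 1) * (2 * |m| * r⁻¹)) :=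
        mul_le_mul_of_nonneg_left hmvt' (Real.rpow_nonneg hr0.le τ)
    _ = 2 * |m| * (|p| * schwCq (p - 1)) * (r ^ τ * r⁻¹) := by ring
    _ = 2 * |m| * (|p| * schwCq (p - 1)) * r ^ (τ - 1) := by rw [hτ']
    _ ≤ 2 * |m| * (|p| * schwCq (p - 1)) * r₀ ^ (τ - 1) := mul_le_mul_of_nonneg_left hrτ hK

/-- **Higher orders**: for `ℓ = n + 1 ≥ 1` and `τ ≤ 1`, `|r^{τ+ℓ} ∂_r^ℓ ((1-2m/r)^p - 1)|` is bounded on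
the tail by the (explicit) list sum of `|c| schwCq(q) r₀^{τ+ℓ+κ}` over the monomials of
`schwDList^[n] [(2mp, -2, p-1)]`. [cite: Ellithy2026, Remark 4.6, p. 40] -/
theorem abs_rpow_mul_iteratedDeriv_schwPow_le (hr₀ : 0 < r₀) (hm : 4 * |m| ≤ r₀) {τ : ℝ}
    (hτ : τ ≤ 1) (p : ℝ) (n : ℕ) {r : ℝ} (hr : r₀ < r) :
    |r ^ (τ + ((n + 1 : ℕ) : ℝ)) * iteratedDeriv (n + 1) (fun ρ ↦ schwPow m p ρ - 1) r| ≤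
      (((schwDList m)^[n] [(2 * m * p, -2, p - 1)]).map
        fun t ↦ |t.1| * schwCq t.2.2 * r₀ ^ (τ + ((n + 1 : ℕ) : ℝ) + t.2.1)).sum := by
  rw [iteratedDeriv_succ_schwPow_sub_one, schwPow_iteratedDeriv_succ_eq hr₀ hm p n hr]
  refine abs_rpow_mul_schwSum_le hr₀ hm _ (fun t ht ↦ ?_) hr
  have h0 : ∀ t ∈ [((2 * m * p, -2, p - 1) : ℝ × ℝ × ℝ)], t.2.1 ≤ -2 := by
    intro t ht; simp only [List.mem_singleton] at ht; rw [ht]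
  have := schwDList_iterate_exponent_le h0 n t ht
  push_cast
  linarith

/-- **Uniform weighted bounds to order `4`** for `(1 - 2m/r)^p - 1` on the tail `r > r₀ ≥ 4|m|`,
`r₀ > 0`, weight `τ ≤ 1`: `‖r^{τ+ℓ} ∂_r^ℓ ((1-2m/r)^p - 1)‖ ≤ B`, `ℓ ≤ 4`. [cite: Ellithy2026, Remark 4.6, p. 40] -/
theorem schwPow_sub_one_weightedBounds (hr₀ : 0 < r₀) (hm : 4 * |m| ≤ r₀) {τ : ℝ} (hτ : τ ≤ 1)
    (p : ℝ) : ∃ B : ℝ, ∀ ℓ ≤ 4, ∀ r, r₀ < r →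
      ‖r ^ (τ + (ℓ : ℕ)) • iteratedDeriv ℓ (fun ρ ↦ schwPow m p ρ - 1) r‖ ≤ B := by
  set B₀ : ℝ := 2 * |m| * (|p| * schwCq (p - 1)) * r₀ ^ (τ - 1) with hB₀
  set BS : ℕ → ℝ := fun n ↦ (((schwDList m)^[n] [(2 * m * p, -2, p - 1)]).map
        fun t ↦ |t.1| * schwCq t.2.2 * r₀ ^ (τ + ((n + 1 : ℕ) : ℝ) + t.2.1)).sum with hBS
  refine ⟨max B₀ (max (BS 0) (max (BS 1) (max (BS 2) (BS 3)))), fun ℓ hℓ r hr ↦ ?_⟩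
  rw [smul_eq_mul, Real.norm_eq_abs]
  rcases Nat.eq_zero_or_eq_succ_pred ℓ with h0 | hsucc
  · subst h0
    simp only [Nat.cast_zero, add_zero, iteratedDeriv_zero]
    exact (abs_rpow_mul_schwPow_sub_one_le hr₀ hm hτ p hr).trans (le_max_left _ _)
  · rw [hsucc]
    refine (abs_rpow_mul_iteratedDeriv_schwPow_le hr₀ hm hτ p ℓ.pred hr).trans ?_
    change BS ℓ.pred ≤ _
    have hpred : ℓ.pred ≤ 3 := by omega
    interval_cases hq : ℓ.pred
    · exact le_max_of_le_right (le_max_left _ _)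
    · exact le_max_of_le_right (le_max_of_le_right (le_max_left _ _))
    · exact le_max_of_le_right (le_max_of_le_right (le_max_of_le_right (le_max_left _ _)))
    · exact le_max_of_le_right (le_max_of_le_right (le_max_of_le_right (le_max_right _ _)))

/-- **Differentiability of all radial derivatives** of `(1 - 2m/r)^p - 1` on the tail.
[cite: Ellithy2026, Remark 4.6, p. 40] -/
theorem differentiableAt_iteratedDeriv_schwPow_sub_one (hr₀ : 0 < r₀) (hm : 4 * |m| ≤ r₀) (p : ℝ)
    (n : ℕ) {r : ℝ} (hr : r₀ < r) :
    DifferentiableAt ℝ (iteratedDeriv n (fun ρ ↦ schwPow m p ρ - 1)) r := by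
  cases n with
  | zero =>
    rw [iteratedDeriv_zero]
    exact (hasDerivAt_schwPow hr₀ hm p hr).differentiableAt.sub_const 1
  | succ n =>
    rw [iteratedDeriv_succ_schwPow_sub_one]
    have hev : iteratedDeriv (n + 1) (schwPow m p) =ᶠ[𝓝 r]
        schwSum m ((schwDList m)^[n] [(2 * m * p, -2, p - 1)]) :=
      Filter.eventuallyEq_of_mem (isOpen_Ioi.mem_nhds hr)
        fun ρ hρ ↦ schwPow_iteratedDeriv_succ_eq hr₀ hm p n hρ
    exact hev.differentiableAt_iff.mpr (hasDerivAt_schwSum hr₀ hm _ hr).differentiableAt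

/-- **Pinching of the Schwarzschild lapse and radial coefficient on the tail**:
`1/2 ≤ (1 - 2m/r)^{±1/2} ≤ 2` for `r > r₀ ≥ 4|m|`, `r₀ > 0`. [cite: Ellithy2026, Remark 4.6, p. 40] -/
theorem schwPow_half_bounds (hr₀ : 0 < r₀) (hm : 4 * |m| ≤ r₀) {r : ℝ} (hr : r₀ < r) :
    ((1 / 2 : ℝ) ≤ schwPow m (1 / 2) r ∧ schwPow m (1 / 2) r ≤ (1 / 2 : ℝ)⁻¹) ∧
      ((1 / 2 : ℝ) ≤ schwPow m (-(1 / 2)) r ∧ schwPow m (-(1 / 2)) r ≤ (1 / 2 : ℝ)⁻¹) := by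
  obtain ⟨hb1, hb2⟩ := schwBase_bounds hr₀ hm hr
  have hb0 : 0 < 1 - 2 * m * r⁻¹ := by linarith
  set b := 1 - 2 * m * r⁻¹ with hb
  have hlow : (1 / 2 : ℝ) ≤ b ^ (1 / 2 : ℝ) :=
    calc (1 / 2 : ℝ) = (1 / 2 : ℝ) ^ (1 : ℝ) := (Real.rpow_one _).symm
      _ ≤ (1 / 2 : ℝ) ^ (1 / 2 : ℝ) :=
          Real.rpow_le_rpow_of_exponent_ge (by norm_num) (by norm_num) (by norm_num)
      _ ≤ b ^ (1 / 2 : ℝ) := Real.rpow_le_rpow (by norm_num) hb1 (by norm_num)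
  have hup : b ^ (1 / 2 : ℝ) ≤ 3 / 2 :=
    calc b ^ (1 / 2 : ℝ) ≤ (3 / 2 : ℝ) ^ (1 / 2 : ℝ) := Real.rpow_le_rpow hb0.le hb2 (by norm_num)
      _ ≤ (3 / 2 : ℝ) ^ (1 : ℝ) := Real.rpow_le_rpow_of_exponent_le (by norm_num) (by norm_num)
      _ = 3 / 2 := Real.rpow_one _
  have hpos : 0 < b ^ (1 / 2 : ℝ) := by linarith
  have hneg : b ^ (-(1 / 2 : ℝ)) = (b ^ (1 / 2 : ℝ))⁻¹ := Real.rpow_neg hb0.le _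
  simp only [schwPow, ← hb]
  refine ⟨⟨hlow, by norm_num; linarith⟩, ?_, ?_⟩
  · rw [hneg]
    calc (1 / 2 : ℝ) ≤ (3 / 2 : ℝ)⁻¹ := by norm_num
      _ ≤ (b ^ (1 / 2 : ℝ))⁻¹ := inv_anti₀ hpos hup
  · rw [hneg]
    exact inv_anti₀ (by norm_num) hlow

end SchwPow

/-! ### The exact Schwarzschild tuple in areal gauge -/

section Tuple

/-- **The exact Schwarzschild exterior of mass `m` in areal gauge, static slicing**:
`N = (1 - 2m/r)^{1/2}`, `λ = (1 - 2m/r)^{-1/2}`, `β = 0`, `b = 0`, `γ = r² γ_{S²}`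
(`g = -(1-2m/r) dt² + (1-2m/r)⁻¹ dr² + r² γ_{S²}`; `m` the ADM mass). [cite: Ellithy2026, Remark 4.6, p. 40] -/
def schwarzschildAreal (m : ℝ) : ADMTailTuple := radial (schwPow m (1 / 2)) (schwPow m (-(1 / 2)))

variable {m r₀ : ℝ}

/-- `N² = 1 - 2m/r` on the tail (the areal-gauge lapse). [cite: Ellithy2026, Remark 4.6, p. 40] -/
theorem schwarzschildAreal_N_sq (hr₀ : 0 < r₀) (hm : 4 * |m| ≤ r₀) (t : ℝ) {r : ℝ} (hr : r₀ < r)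
    (p : sphere (0 : E3) 1) : (schwarzschildAreal m).N t r p ^ 2 = 1 - 2 * m * r⁻¹ := by
  have hb := schwBase_pos hr₀ hm hr
  show schwPow m (1 / 2) r ^ 2 = _
  rw [schwPow, ← Real.rpow_natCast, ← Real.rpow_mul hb.le]
  norm_num

/-- `N λ = 1` on the tail (`g_{rr} = N⁻²`, the areal gauge). [cite: Ellithy2026, Remark 4.6, p. 40] -/
theorem schwarzschildAreal_N_mul_lam (hr₀ : 0 < r₀) (hm : 4 * |m| ≤ r₀) (t : ℝ) {r : ℝ} (hr : r₀ < r)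
    (p : sphere (0 : E3) 1) : (schwarzschildAreal m).N t r p * (schwarzschildAreal m).lam t r p = 1 := by
  have hb := schwBase_pos hr₀ hm hr
  show schwPow m (1 / 2) r * schwPow m (-(1 / 2)) r = 1
  rw [schwPow, schwPow, ← Real.rpow_add hb]
  norm_num

/-- **The exact Schwarzschild exterior (areal gauge, static slices) lies in the strengthened class
`𝒞𝒮♯_{-τ}(ℳ_{T̲,r₀})` of Def. 3.8** for every `r₀ > 0` with `r₀ ≥ 4|m|`, every `0 < α ≤ 2`, every
`τ ≤ 1` and every `T̲` — the tuple-level content of "the stationary … Schwarzschild exteriors are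
compatible with the final-state hypotheses" (Remark 4.6), now without truncation in `m/r`.
[cite: Ellithy2026, Remark 4.6, p. 40; Def. 3.8, p. 22] -/
theorem schwarzschildAreal_isSharpTailCoeff (hr₀ : 0 < r₀) (hm : 4 * |m| ≤ r₀) {α τ : ℝ} (hα : 0 < α)
    (hα2 : α ≤ 2) (hτ : τ ≤ 1) (Tlo : ℝ) : (schwarzschildAreal m).IsSharpTailCoeff α τ Tlo r₀ := by
  obtain ⟨Bf, hBf⟩ := schwPow_sub_one_weightedBounds hr₀ hm hτ (1 / 2)
  obtain ⟨Bg, hBg⟩ := schwPow_sub_one_weightedBounds hr₀ hm hτ (-(1 / 2))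
  refine radial_isSharpTailCoeff_of_profile (δ := 1 / 2) (ϑ := 1 / 2) (B := max Bf Bg) hr₀ hα hα2
    (by norm_num) (by norm_num) (fun r hr ↦ (schwPow_half_bounds hr₀ hm hr).2)
    (fun r hr ↦ (schwPow_half_bounds hr₀ hm hr).1)
    (fun n _ r hr ↦ differentiableAt_iteratedDeriv_schwPow_sub_one hr₀ hm _ n hr)
    (fun n _ r hr ↦ differentiableAt_iteratedDeriv_schwPow_sub_one hr₀ hm _ n hr)
    (fun ℓ hℓ r hr ↦ (hBf ℓ hℓ r hr).trans (le_max_left _ _))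
    (fun ℓ hℓ r hr ↦ (hBg ℓ hℓ r hr).trans (le_max_right _ _)) Tlo

/-- With the rest-frame clause of §4.1 (zero ADM momentum flux on every slice, `radial_isRestFrame`), in
the window `α ∈ (0,1)`, `τ ∈ (1/2, 1)` of Def. 4.4: the exact Schwarzschild tuple satisfies
`IsSharpTailCoeff ∧ IsRestFrame`. [cite: Ellithy2026, Remark 4.6, p. 40; Def. 4.4, p. 39; §4.1, p. 38] -/
theorem schwarzschildAreal_restFrameTuple (hr₀ : 0 < r₀) (hm : 4 * |m| ≤ r₀) {α τ : ℝ}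
    (hα : α ∈ Set.Ioo (0 : ℝ) 1) (hτ : τ ∈ Set.Ioo (1 / 2 : ℝ) 1) (Tlo : ℝ) :
    (schwarzschildAreal m).IsSharpTailCoeff α τ Tlo r₀ ∧ (schwarzschildAreal m).IsRestFrame Tlo :=
  ⟨schwarzschildAreal_isSharpTailCoeff hr₀ hm hα.1 (by linarith [hα.2]) hτ.2.le Tlo,
    radial_isRestFrame _ _ Tlo⟩

end Tuple

/-! ### The static spherically symmetric family: gauge reducibility and forcing decay -/

section RadialGauge

variable (f g : ℝ → ℝ)

/-- The normal shift of a static spherically symmetric tuple vanishes: `β^⊥ = 0` (`β = 0`).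
[cite: Ellithy2026, Def. 3.8, p. 22] -/
theorem radial_betaPerp (t : ℝ) : (radial f g).betaPerp t = fun _ _ ↦ 0 := by
  funext r p; simp [ADMTailTuple.betaPerp, radial_βCart_apply]

/-- `𝔅♯(T; r₁) = 0` for a static spherically symmetric tuple. [cite: Ellithy2026, Def. 3.8, p. 22] -/
theorem radial_normalShiftTail (α τ Tlo r₁ T : ℝ) : (radial f g).normalShiftTail α τ Tlo r₁ T = 0 := by
  rw [show (radial f g).normalShiftTail α τ Tlo r₁ T = flat.normalShiftTail α τ Tlo r₁ T by
    simp only [ADMTailTuple.normalShiftTail, radial_betaPerp, flat_betaPerp]]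
  exact flat_normalShiftTail α τ Tlo r₁ T

/-- **A static spherically symmetric tuple of the strengthened class is late-time gauge reducible**
(Def. 3.29: `𝔅♯(T; r₁) → 0`, here `≡ 0`). [cite: Ellithy2026, Def. 3.29, p. 34] -/
theorem radial_isGaugeReducible {α τ Tlo r₀ : ℝ} (h : (radial f g).IsSharpTailCoeff α τ Tlo r₀) :
    (radial f g).IsGaugeReducible α τ Tlo r₀ := by
  refine ⟨h, fun r₁ _ ↦ ?_⟩
  simp only [ADMTailTuple.HasDecayingNormalShift, radial_normalShiftTail]
  exact tendsto_const_nhds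

/-- **A static spherically symmetric tuple satisfies the late forcing decay (A1) ∧ (A2)** (Def. 3.28;
its forcing `Ξ = λ tr_γ K` vanishes, `K_t ≡ 0`), `r₀ > 0`, `λ` differentiable on the tail.
[cite: Ellithy2026, Def. 3.28, p. 34] -/
theorem radial_hasLateForcingDecay {r₀ : ℝ} (hr₀ : 0 < r₀)
    (hg : ∀ ρ, r₀ < ρ → DifferentiableAt ℝ g ρ) (α τ Tlo : ℝ) :
    (radial f g).HasLateForcingDecay α τ Tlo r₀ := by
  have hX0 : ∀ r₁, r₀ < r₁ → ∀ T σ, r₁ < σ → (radial f g).X0 Tlo σ T = 0 := fun r₁ hr₁ T σ hσ ↦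
    radial_X0 f g Tlo T (hr₀.trans (hr₁.trans hσ)) (hg σ (hr₁.trans hσ))
  have hX1 : ∀ r₁, r₀ < r₁ → ∀ T σ, r₁ < σ → (radial f g).X1 Tlo σ T = 0 := fun r₁ hr₁ T σ hσ ↦
    radial_X1 f g Tlo T (hr₀.trans (hr₁.trans hσ)) (hg σ (hr₁.trans hσ))
  have hX2 : ∀ r₁, r₀ < r₁ → ∀ T σ, r₁ < σ → (radial f g).X2 Tlo σ T = 0 := fun r₁ hr₁ T σ hσ ↦
    radial_X2 f g Tlo T (hr₀.trans (hr₁.trans hσ)) (hg σ (hr₁.trans hσ))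
  have hG : ∀ r₁, r₀ < r₁ → ∀ T, (radial f g).tailG Tlo r₁ T = 0 := by
    intro r₁ hr₁ T
    have hae : ∀ᵐ σ ∂(volume.restrict (Ioi r₁)), (radial f g).X0 Tlo σ T / ENNReal.ofReal σ = 0 := by
      filter_upwards [ae_restrict_mem measurableSet_Ioi] with σ hσ
      rw [hX0 r₁ hr₁ T σ hσ, ENNReal.zero_div]
    simp only [ADMTailTuple.tailG]
    rw [lintegral_congr_ae hae, lintegral_zero]
  have hP1 : ∀ r₁, r₀ < r₁ → ∀ T, (radial f g).tailPhi1 Tlo r₁ T = 0 := by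
    intro r₁ hr₁ T
    have hae : ∀ᵐ σ ∂(volume.restrict (Ioi r₁)), (radial f g).X1 Tlo σ T = 0 := by
      filter_upwards [ae_restrict_mem measurableSet_Ioi] with σ hσ
      rw [hX1 r₁ hr₁ T σ hσ]
    simp only [ADMTailTuple.tailPhi1]
    rw [lintegral_congr_ae hae, lintegral_zero]
  have hP2 : ∀ r₁, r₀ < r₁ → ∀ T, (radial f g).tailPhi2 Tlo r₁ T = 0 := by
    intro r₁ hr₁ T
    have hae : ∀ᵐ σ ∂(volume.restrict (Ioi r₁)), (radial f g).X2 Tlo σ T = 0 := by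
      filter_upwards [ae_restrict_mem measurableSet_Ioi] with σ hσ
      rw [hX2 r₁ hr₁ T σ hσ]
    simp only [ADMTailTuple.tailPhi2]
    rw [lintegral_congr_ae hae, lintegral_zero]
  have hΩ : ∀ r₁, r₀ < r₁ → ∀ T, (radial f g).tailOmega Tlo r₁ T = 0 := by
    intro r₁ hr₁ T
    simp only [ADMTailTuple.tailOmega]
    refine le_antisymm (iSup₂_le fun r hr ↦ ?_) bot_le
    rw [radial_X0 f g Tlo T (hr₀.trans (hr₁.trans_le hr)) (hg r (hr₁.trans_le hr))]
  refine ⟨fun r₁ hr₁ ↦ ⟨?_, ?_⟩, Or.inl fun r₁ hr₁ ↦ ⟨?_, ?_⟩⟩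
  · simp only [hG r₁ hr₁]; exact tendsto_const_nhds
  · simp only [hP1 r₁ hr₁]; exact tendsto_const_nhds
  · simp only [hP2 r₁ hr₁]; exact tendsto_const_nhds
  · simp only [hΩ r₁ hr₁]; exact tendsto_const_nhds

end RadialGauge

/-! ### The Cartesian model `(ℝ × E3, g_static)` inhabits the analytic quasi-final-state predicate -/

section StaticModel

variable {m r₀ : ℝ}

/-- `(1 - 2m/r)^{±1/2}` is differentiable on the tail. [cite: Ellithy2026, Remark 4.6, p. 40] -/
theorem differentiableAt_schwPow (hr₀ : 0 < r₀) (hm : 4 * |m| ≤ r₀) (p : ℝ) {r : ℝ} (hr : r₀ < r) :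
    DifferentiableAt ℝ (schwPow m p) r := by
  have h := differentiableAt_iteratedDeriv_schwPow_sub_one hr₀ hm p 0 hr
  rw [iteratedDeriv_zero] at h
  have h' := h.add_const 1
  simp only [sub_add_cancel] at h'
  exact h'

/-- **The exact Schwarzschild tuple is late-time gauge reducible** (Def. 3.29; `β = 0`).
[cite: Ellithy2026, Def. 3.29, p. 34; Remark 4.6, p. 40] -/
theorem schwarzschildAreal_isGaugeReducible (hr₀ : 0 < r₀) (hm : 4 * |m| ≤ r₀) {α τ : ℝ}
    (hα : 0 < α) (hα2 : α ≤ 2) (hτ : τ ≤ 1) (Tlo : ℝ) :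
    (schwarzschildAreal m).IsGaugeReducible α τ Tlo r₀ :=
  radial_isGaugeReducible _ _ (schwarzschildAreal_isSharpTailCoeff hr₀ hm hα hα2 hτ Tlo)

/-- **The exact Schwarzschild tuple satisfies the late forcing decay** (Def. 3.28 (A1) ∧ (A2); static
slices, `K_t ≡ 0`). [cite: Ellithy2026, Def. 3.28, p. 34; Remark 4.6, p. 40] -/
theorem schwarzschildAreal_hasLateForcingDecay (hr₀ : 0 < r₀) (hm : 4 * |m| ≤ r₀) (α τ Tlo : ℝ) :
    (schwarzschildAreal m).HasLateForcingDecay α τ Tlo r₀ :=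
  radial_hasLateForcingDecay _ _ hr₀ (fun _ hρ ↦ differentiableAt_schwPow hr₀ hm _ hρ) α τ Tlo

/-- **The static Schwarzschild metric in Cartesian slice coordinates** `(t, y)`, `r = |y|`:
`g_static(t, y) = -(1 - 2m/r) dt² + dy² + (2m/(r - 2m)) dr²`, `dr = ⟪y, dy⟫/r` — by definition the ADM
form of the areal tuple (`ADMTailTuple.admForm`; its explicit value is `schwarzschildStaticForm_apply`,
and it is the tree's `Schwarzschild.staticBilin` read through `(t, y) ↦ (t, y⁰, y¹, y²)`,
`schwarzschildStaticForm_eq_staticBilin`). Junk inside `r ≤ 2m`. [cite: Ellithy2026, Remark 4.6, p. 40] -/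
def schwarzschildStaticForm (m : ℝ) (x : ℝ × E3) : (ℝ × E3) →L[ℝ] (ℝ × E3) →L[ℝ] ℝ :=
  (schwarzschildAreal m).admForm x.1 x.2

/-- Explicit value: `g_static((a, Y), (a', Y')) = -(1 - 2m/|y|) a a' + ⟪Y, Y'⟫
+ (2m/(|y| - 2m)) (⟪y, Y⟫/|y|)(⟪y, Y'⟫/|y|)` at `|y| > r₀ ≥ 4|m|`. [cite: Ellithy2026, Remark 4.6, p. 40] -/
theorem schwarzschildStaticForm_apply (hr₀ : 0 < r₀) (hm : 4 * |m| ≤ r₀) (t : ℝ) {y : E3}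
    (hy : r₀ < ‖y‖) (v w : ℝ × E3) :
    schwarzschildStaticForm m (t, y) v w =
      -((1 - 2 * m * ‖y‖⁻¹) * (v.1 * w.1)) + ⟪v.2, w.2⟫ +
        2 * m / (‖y‖ - 2 * m) * ((⟪y, v.2⟫ / ‖y‖) * (⟪y, w.2⟫ / ‖y‖)) := by
  have hn : 0 < ‖y‖ := hr₀.trans hy
  have hy0 : y ≠ 0 := norm_pos_iff.mp hn
  have hb : 0 < 1 - 2 * m * ‖y‖⁻¹ := schwBase_pos hr₀ hm hy
  have hN : (schwarzschildAreal m).N t ‖y‖ (raySphere y) ^ 2 = 1 - 2 * m * ‖y‖⁻¹ :=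
    schwarzschildAreal_N_sq hr₀ hm t hy (raySphere y)
  have hlam2 : schwPow m (-(1 / 2)) ‖y‖ ^ 2 - 1 = 2 * m / (‖y‖ - 2 * m) := by
    rw [schwPow, ← Real.rpow_natCast, ← Real.rpow_mul hb.le]
    norm_num
    rw [Real.rpow_neg_one]
    have hden : ‖y‖ - 2 * m ≠ 0 := by
      have e : ‖y‖ * (1 - 2 * m * ‖y‖⁻¹) = ‖y‖ - 2 * m := by field_simp
      have h2 : 0 < ‖y‖ - 2 * m := by
        have := mul_pos hn hb
        rwa [e] at this
      exact h2.ne'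
    field_simp
    ring
  have hβ : (schwarzschildAreal m).βCart t y = 0 := radial_βCart_apply _ _ t y
  have hβn : (schwarzschildAreal m).betaNormSq t y = 0 := by
    simp [ADMTailTuple.betaNormSq, hβ]
  have hg : (schwarzschildAreal m).gCart t y =
      innerBil + ((schwPow m (-(1 / 2)) ‖y‖ ^ 2 - 1) * (‖y‖ ^ 2)⁻¹) •
        (innerSL ℝ y).smulRight (innerSL ℝ y) := radial_gCart_eq _ _ t hy0
  simp only [schwarzschildStaticForm, ADMTailTuple.admForm, hβn, hβ, hN, hg, hlam2,
    add_apply, smul_apply,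
    ContinuousLinearMap.bilinearComp_apply, ContinuousLinearMap.mul_apply',
    ContinuousLinearMap.coe_fst', ContinuousLinearMap.coe_snd',
    zero_apply, ContinuousLinearMap.zero_comp, ContinuousLinearMap.smulRight_apply,
    innerSL_apply_apply, innerBil_apply, smul_eq_mul]
  field_simp
  ring

/-- **Non-vacuity of the typed analytic quasi-final-state clauses at positive mass**: the Cartesian
model `(ℝ × E3, g_static)` of the exact Schwarzschild exterior of mass `m`, with the polar late chart
`Φ(t, r, p) = (t, r p)`, satisfies `IsQuasiFinalAnalytic` — Def. 4.4 (1) (ADM form on `r > r₀`,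
coefficient tuple in `𝒞𝒮♯_{-τ}`) + (2) (gauge reducibility, forcing decay) + §4.1 (rest frame) — for
every `r₀ > 0` with `r₀ ≥ 4|m|` and every `T̲` (witnesses `α = 1/2`, `τ = 3/4`,
`𝒮 = schwarzschildAreal m`). [cite: Ellithy2026, Def. 4.4, p. 39; Remark 4.6, p. 40] -/
theorem schwarzschildStatic_isQuasiFinalAnalytic (hr₀ : 0 < r₀) (hm : 4 * |m| ≤ r₀) (Tlo : ℝ) :
    IsQuasiFinalAnalytic 𝓘(ℝ, ℝ × E3) (M := ℝ × E3) (schwarzschildStaticForm m) minkPolarChart Tlo r₀ := by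
  have hADM : HasADMForm 𝓘(ℝ, ℝ × E3) (M := ℝ × E3) (schwarzschildStaticForm m) minkPolarChart Tlo r₀
      (schwarzschildAreal m) := by
    intro t y _ hy
    have hy0 : y ≠ 0 := norm_pos_iff.mp (hr₀.trans hy)
    have hq : ((t, y) : ℝ × E3).2 ≠ 0 := hy0
    have hopen : IsOpen {q' : ℝ × E3 | q'.2 ≠ 0} := isOpen_ne_fun continuous_snd continuous_const
    have hev : polarChart minkPolarChart =ᶠ[𝓝 ((t, y) : ℝ × E3)] id :=
      Filter.eventuallyEq_of_mem (hopen.mem_nhds hq) fun q' hq' ↦ polarChart_minkPolarChart_eq hq'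
    have hd : mfderiv 𝓘(ℝ, ℝ × E3) 𝓘(ℝ, ℝ × E3) (polarChart minkPolarChart) (t, y) =
        ContinuousLinearMap.id ℝ (ℝ × E3) := by
      rw [hev.mfderiv_eq, mfderiv_id]; rfl
    have hpt : polarChart minkPolarChart ((t, y) : ℝ × E3) = (t, y) := polarChart_minkPolarChart_eq hq
    refine ContinuousLinearMap.ext fun v ↦ ContinuousLinearMap.ext fun w ↦ ?_
    change schwarzschildStaticForm m (polarChart minkPolarChart ((t, y) : ℝ × E3))
        (mfderiv 𝓘(ℝ, ℝ × E3) 𝓘(ℝ, ℝ × E3) (polarChart minkPolarChart) (t, y) v)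
        (mfderiv 𝓘(ℝ, ℝ × E3) 𝓘(ℝ, ℝ × E3) (polarChart minkPolarChart) (t, y) w) =
      (schwarzschildAreal m).admForm t y v w
    rw [hd, hpt]
    rfl
  refine ⟨hr₀, 1 / 2, ⟨by norm_num, by norm_num⟩, 3 / 4, ⟨by norm_num, by norm_num⟩,
    schwarzschildAreal m, hADM, ?_, ?_, ?_, radial_isRestFrame _ _ Tlo⟩
  · exact schwarzschildAreal_isSharpTailCoeff hr₀ hm (by norm_num) (by norm_num) (by norm_num) Tlo
  · exact schwarzschildAreal_isGaugeReducible hr₀ hm (by norm_num) (by norm_num) (by norm_num) Tlo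
  · exact schwarzschildAreal_hasLateForcingDecay hr₀ hm _ _ Tlo

/-- **Dictionary with the tree's static Schwarzschild chart**: read through the identification
`(t, y) ↦ (t, y⁰, y¹, y²)` of `ℝ × E3` with `E4`, the ADM form of the areal tuple IS the static
Schwarzschild metric in Cartesian coordinates `Schwarzschild.staticBilin m`
(`SchwarzschildStaticChart`: `-(1 - 2M/r) dt² + dx⃗² + (2M/(r - 2M)) dr²`, Griffiths–Podolský 2009,
(8.1); there pulled back from the Kerr–Schild chart of `Kerr.exterior M 0` by the Eddington–Finkelstein
change of time), at every `|y| > r₀ ≥ 4|m|`. [cite: GriffithsPodolsky2009, §8.1 (8.1)] -/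
theorem schwarzschildStaticForm_eq_staticBilin (hr₀ : 0 < r₀) (hm : 4 * |m| ≤ r₀) (t : ℝ) {y : E3}
    (hy : r₀ < ‖y‖) (v w : ℝ × E3) :
    schwarzschildStaticForm m (t, y) v w =
      Schwarzschild.staticBilin m (E4.ofTimeSpace t y) (E4.ofTimeSpace v.1 v.2) (E4.ofTimeSpace w.1 w.2) := by
  rw [schwarzschildStaticForm_apply hr₀ hm t hy, Schwarzschild.staticBilin_apply]
  simp only [Schwarzschild.nu, Schwarzschild.sdot, E4.spatial_ofTimeSpace, E4.spatialNorm_ofTimeSpace,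
    E4.ofTimeSpace_apply_zero, div_eq_mul_inv]

end StaticModel


/-! ### The collar sentence for the static model: uniform `C²` control on fixed collars -/

section StaticCollar

variable {m r₀ : ℝ}

/-- In the polar late chart of the Cartesian model, the chart metric of ANY field of bilinear forms is
the field itself off the axis (`Φ ∘ polar = id` there). [cite: Ellithy2026, Def. 4.4, p. 39] -/
theorem pullbackBilin_minkPolarChart_of (g : ℝ × E3 → (ℝ × E3) →L[ℝ] (ℝ × E3) →L[ℝ] ℝ)
    {q : ℝ × E3} (hq : q.2 ≠ 0) :
    pullbackBilin (I := 𝓘(ℝ, ℝ × E3)) (I' := 𝓘(ℝ, ℝ × E3)) (M := ℝ × E3) (polarChart minkPolarChart) g q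
      = g q := by
  have hopen : IsOpen {q' : ℝ × E3 | q'.2 ≠ 0} := isOpen_ne_fun continuous_snd continuous_const
  have hev : polarChart minkPolarChart =ᶠ[𝓝 q] id :=
    Filter.eventuallyEq_of_mem (hopen.mem_nhds hq) fun q' hq' ↦ polarChart_minkPolarChart_eq hq'
  have hd : mfderiv 𝓘(ℝ, ℝ × E3) 𝓘(ℝ, ℝ × E3) (polarChart minkPolarChart) q =
      ContinuousLinearMap.id ℝ (ℝ × E3) := by
    rw [hev.mfderiv_eq, mfderiv_id]; rfl
  have hpt : polarChart minkPolarChart q = q := polarChart_minkPolarChart_eq hq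
  refine ContinuousLinearMap.ext fun v ↦ ContinuousLinearMap.ext fun w ↦ ?_
  change g (polarChart minkPolarChart q) (mfderiv 𝓘(ℝ, ℝ × E3) 𝓘(ℝ, ℝ × E3) (polarChart minkPolarChart) q v)
      (mfderiv 𝓘(ℝ, ℝ × E3) 𝓘(ℝ, ℝ × E3) (polarChart minkPolarChart) q w) = g q v w
  rw [hd, hpt]
  rfl

/-- The radial covector `dr̃_y = ⟪y, dy⟫` on `ℝ × E3` (unnormalised). [folklore] -/
def radCovec (y : E3) : (ℝ × E3) →L[ℝ] ℝ := (innerSL ℝ y).comp (ContinuousLinearMap.snd ℝ ℝ E3)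

/-- `radCovec y (a, Y) = ⟪y, Y⟫`. [folklore] -/
@[simp] private theorem radCovec_apply (y : E3) (v : ℝ × E3) : radCovec y v = ⟪y, v.2⟫ := rfl

/-- `dt ⊗ dt` on `ℝ × E3`. [folklore] -/
def dtdt : (ℝ × E3) →L[ℝ] (ℝ × E3) →L[ℝ] ℝ :=
  (ContinuousLinearMap.fst ℝ ℝ E3).smulRight (ContinuousLinearMap.fst ℝ ℝ E3)

/-- `dtdt (a, Y) (a', Y') = a a'`. [folklore] -/
@[simp] private theorem dtdt_apply (v w : ℝ × E3) : dtdt v w = v.1 * w.1 := by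
  simp [dtdt, ContinuousLinearMap.smulRight_apply]

/-- **The static Schwarzschild form as an explicit smooth field of bilinear forms on `y ≠ 0`,
`|y| ≠ 2m`**: `G'(y) = η + (2m/|y|) dt² + (2m/((|y| - 2m)|y|²)) ⟪y, dy⟫²` (Griffiths–Podolský 2009,
(8.1), in the slice coordinates `(t, y)`; it agrees with `schwarzschildStaticForm m (t, y)` for
`|y| > r₀ ≥ 4|m|`, `schwarzschildStaticField_eq`). [cite: GriffithsPodolsky2009, §8.1 (8.1)] -/
def schwarzschildStaticField (m : ℝ) (y : E3) : (ℝ × E3) →L[ℝ] (ℝ × E3) →L[ℝ] ℝ :=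
  minkForm + (2 * m * ‖y‖⁻¹) • dtdt +
    (2 * m / (‖y‖ - 2 * m) * (‖y‖ ^ 2)⁻¹) • (radCovec y).smulRight (radCovec y)

/-- Explicit value of the static field. [cite: GriffithsPodolsky2009, §8.1 (8.1)] -/
theorem schwarzschildStaticField_apply (m : ℝ) (y : E3) (v w : ℝ × E3) :
    schwarzschildStaticField m y v w =
      -((1 - 2 * m * ‖y‖⁻¹) * (v.1 * w.1)) + ⟪v.2, w.2⟫ +
        2 * m / (‖y‖ - 2 * m) * (‖y‖ ^ 2)⁻¹ * (⟪y, v.2⟫ * ⟪y, w.2⟫) := by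
  simp only [schwarzschildStaticField, add_apply, smul_apply, minkForm_apply, dtdt_apply,
    ContinuousLinearMap.smulRight_apply, radCovec_apply, smul_eq_mul]
  ring

/-- On `|y| > r₀ ≥ 4|m|` the explicit field is the static form `schwarzschildStaticForm m (t, y)` (every
`t`). [cite: GriffithsPodolsky2009, §8.1 (8.1)] -/
theorem schwarzschildStaticField_eq (hr₀ : 0 < r₀) (hm : 4 * |m| ≤ r₀) (t : ℝ) {y : E3}
    (hy : r₀ < ‖y‖) : schwarzschildStaticField m y = schwarzschildStaticForm m (t, y) := by
  have hn : ‖y‖ ≠ 0 := (hr₀.trans hy).ne'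
  refine ContinuousLinearMap.ext fun v ↦ ContinuousLinearMap.ext fun w ↦ ?_
  rw [schwarzschildStaticField_apply, schwarzschildStaticForm_apply hr₀ hm t hy]
  field_simp

/-- The explicit field is `C^∞` on `y ≠ 0`, `|y| ≠ 2m`. [cite: GriffithsPodolsky2009, §8.1 (8.1)] -/
theorem contDiffAt_schwarzschildStaticField {n : WithTop ℕ∞} {y : E3} (hy : y ≠ 0)
    (hy2 : ‖y‖ - 2 * m ≠ 0) : ContDiffAt ℝ n (schwarzschildStaticField m) y := by
  have hnorm : ContDiffAt ℝ n (fun y : E3 ↦ ‖y‖) y := contDiffAt_norm ℝ hy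
  have hn0 : ‖y‖ ≠ 0 := norm_ne_zero_iff.mpr hy
  have h1 : ContDiffAt ℝ n (fun y : E3 ↦ 2 * m * ‖y‖⁻¹) y := contDiffAt_const.mul (hnorm.inv hn0)
  have h2 : ContDiffAt ℝ n (fun y : E3 ↦ 2 * m / (‖y‖ - 2 * m) * (‖y‖ ^ 2)⁻¹) y :=
    (contDiffAt_const.div (hnorm.sub contDiffAt_const) hy2).mul ((hnorm.pow 2).inv (pow_ne_zero 2 hn0))
  have hcov : ContDiff ℝ n (fun y : E3 ↦ radCovec y) :=
    ((innerSL ℝ (E := E3)).contDiff).clm_comp contDiff_const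
  have h3 : ContDiffAt ℝ n (fun y : E3 ↦ (radCovec y).smulRight (radCovec y)) y :=
    (hcov.smulRight hcov).contDiffAt
  unfold schwarzschildStaticField
  exact (contDiffAt_const.add (h1.smul contDiffAt_const)).add (h2.smul h3)

/-- The explicit field is `C^∞` on the open set `{|y| > r₀/2}` when `r₀ ≥ 4|m|`, `r₀ > 0`.
[cite: GriffithsPodolsky2009, §8.1 (8.1)] -/
theorem contDiffOn_schwarzschildStaticField (hr₀ : 0 < r₀) (hm : 4 * |m| ≤ r₀) {n : WithTop ℕ∞} :
    ContDiffOn ℝ n (schwarzschildStaticField m) {y : E3 | r₀ / 2 < ‖y‖} := by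
  intro y hy
  have hy0 : y ≠ 0 := by
    intro h; simp only [mem_setOf_eq, h, norm_zero] at hy; linarith
  have hy2 : ‖y‖ - 2 * m ≠ 0 := by
    have : 2 * m ≤ 2 * |m| := by linarith [le_abs_self m]
    have hy' : r₀ / 2 < ‖y‖ := hy
    intro h; linarith
  exact (contDiffAt_schwarzschildStaticField hy0 hy2).contDiffWithinAt

/-- **Uniform nondegeneracy of the static field w.r.t. the sup norm of `ℝ × E3`**: `‖G'(y) v‖ ≥ ‖v‖/3`
for `|y| ≥ 3|m|`, `y ≠ 0` (test vectors `(a, 0)` and `(0, V)`: `1 - 2m/|y| ≥ 1/3` and the spatial part is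
`≥ (3/5)|V|²`). [cite: GriffithsPodolsky2009, §8.1 (8.1)] -/
theorem norm_le_norm_schwarzschildStaticField {y : E3} (hy0 : 0 < ‖y‖) (hy : 3 * |m| ≤ ‖y‖)
    (v : ℝ × E3) : (1 / 3 : ℝ) * ‖v‖ ≤ ‖schwarzschildStaticField m y v‖ := by
  have habs : |2 * m * ‖y‖⁻¹| ≤ 2 / 3 := by
    rw [abs_mul, abs_mul, abs_two, abs_inv, abs_of_pos hy0, ← div_eq_mul_inv, div_le_iff₀ hy0]
    linarith
  obtain ⟨hA1, hA2⟩ := abs_le.mp habs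
  -- the time-time test vector
  have ht : (1 / 3 : ℝ) * |v.1| ≤ ‖schwarzschildStaticField m y v‖ := by
    have h := (schwarzschildStaticField m y v).le_opNorm ((v.1, 0) : ℝ × E3)
    have e1 : schwarzschildStaticField m y v ((v.1, 0) : ℝ × E3) = -((1 - 2 * m * ‖y‖⁻¹) * (v.1 * v.1)) := by
      rw [schwarzschildStaticField_apply]; simp
    have e2 : ‖((v.1, 0) : ℝ × E3)‖ = |v.1| := by
      rw [Prod.norm_mk, norm_zero, Real.norm_eq_abs, max_eq_left (abs_nonneg _)]
    rw [e1, e2, norm_neg, Real.norm_eq_abs, abs_mul, abs_mul, abs_of_pos (by linarith : (0:ℝ) < 1 - 2 * m * ‖y‖⁻¹)] at h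
    by_cases h0 : v.1 = 0
    · rw [h0, abs_zero, mul_zero]; exact norm_nonneg _
    · have hpos : 0 < |v.1| := abs_pos.mpr h0
      have : (1 / 3 : ℝ) * |v.1| * |v.1| ≤ ‖schwarzschildStaticField m y v‖ * |v.1| := by
        nlinarith
      exact le_of_mul_le_mul_right this hpos
  -- the space-space test vector
  have hs : (1 / 3 : ℝ) * ‖v.2‖ ≤ ‖schwarzschildStaticField m y v‖ := by
    have h := (schwarzschildStaticField m y v).le_opNorm ((0, v.2) : ℝ × E3)
    have e1 : schwarzschildStaticField m y v ((0, v.2) : ℝ × E3) =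
        ‖v.2‖ ^ 2 + 2 * m / (‖y‖ - 2 * m) * (‖y‖ ^ 2)⁻¹ * ⟪y, v.2⟫ ^ 2 := by
      rw [schwarzschildStaticField_apply]; simp [sq]
    have e2 : ‖((0, v.2) : ℝ × E3)‖ = ‖v.2‖ := by
      rw [Prod.norm_mk, norm_zero, max_eq_right (norm_nonneg _)]
    -- the quadratic form is ≥ (3/5) |V|²
    have hcs : ⟪y, v.2⟫ ^ 2 ≤ ‖y‖ ^ 2 * ‖v.2‖ ^ 2 := by
      have := abs_real_inner_le_norm y v.2
      have h0 : 0 ≤ ‖y‖ * ‖v.2‖ := by positivity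
      nlinarith [sq_abs ⟪y, v.2⟫, abs_nonneg ⟪y, v.2⟫]
    have hq : (3 / 5 : ℝ) * ‖v.2‖ ^ 2 ≤ ‖v.2‖ ^ 2 + 2 * m / (‖y‖ - 2 * m) * (‖y‖ ^ 2)⁻¹ * ⟪y, v.2⟫ ^ 2 := by
      have hden : 0 < ‖y‖ - 2 * m := by linarith [le_abs_self m]
      rcases le_or_gt 0 m with hm0 | hm0
      · have : 0 ≤ 2 * m / (‖y‖ - 2 * m) * (‖y‖ ^ 2)⁻¹ * ⟪y, v.2⟫ ^ 2 := by positivity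
        nlinarith [sq_nonneg ‖v.2‖]
      · -- negative mass: |2m/(|y|-2m)| ≤ 2/5
        have hm' : |m| = -m := abs_of_neg hm0
        have hden' : 5 * |m| ≤ ‖y‖ - 2 * m := by linarith
        have hcoef : -(2 / 5 : ℝ) ≤ 2 * m / (‖y‖ - 2 * m) := by
          rw [le_div_iff₀ hden]; nlinarith [abs_nonneg m]
        have hneg : 2 * m / (‖y‖ - 2 * m) ≤ 0 :=
          div_nonpos_of_nonpos_of_nonneg (by linarith) hden.le
        have hy2 : (‖y‖ ^ 2)⁻¹ * ⟪y, v.2⟫ ^ 2 ≤ ‖v.2‖ ^ 2 := by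
          rw [inv_mul_le_iff₀ (by positivity)]; linarith
        have hy2' : 0 ≤ (‖y‖ ^ 2)⁻¹ * ⟪y, v.2⟫ ^ 2 := by positivity
        calc (3 / 5 : ℝ) * ‖v.2‖ ^ 2 = ‖v.2‖ ^ 2 + -(2 / 5 : ℝ) * ‖v.2‖ ^ 2 := by ring
          _ ≤ ‖v.2‖ ^ 2 + 2 * m / (‖y‖ - 2 * m) * ((‖y‖ ^ 2)⁻¹ * ⟪y, v.2⟫ ^ 2) := by
              nlinarith
          _ = _ := by ring
    rw [e1, e2, Real.norm_eq_abs] at h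
    by_cases h0 : ‖v.2‖ = 0
    · rw [h0, mul_zero]; exact norm_nonneg _
    · have hpos : 0 < ‖v.2‖ := lt_of_le_of_ne (norm_nonneg _) (Ne.symm h0)
      have hq' : (1 / 3 : ℝ) * ‖v.2‖ * ‖v.2‖ ≤ |‖v.2‖ ^ 2 + 2 * m / (‖y‖ - 2 * m) * (‖y‖ ^ 2)⁻¹ * ⟪y, v.2⟫ ^ 2| := by
        refine le_trans ?_ (le_abs_self _)
        nlinarith [sq_nonneg ‖v.2‖]
      exact le_of_mul_le_mul_right (hq'.trans h) hpos
  rw [Prod.norm_def]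
  rcases le_total ‖v.1‖ ‖v.2‖ with h12 | h12
  · rw [max_eq_right h12]; exact hs
  · rw [max_eq_left h12, Real.norm_eq_abs]; exact ht

/-- **The static Schwarzschild model has uniform `C²` control on every collar** `[r₀, r₁]` in its
polar chart (the collar sentence of Def. 4.4 (1) as typed in `QuasiFinalCollarControl`): width
`ε = r₀/4`, the field `G(t, y) = G'(y)` above (static, smooth on `|y| > r₀/2 ⊇` the closed collar,
whence bounded derivatives by compactness), `c = 1/3`; every `r₀ > 0`, `r₀ ≥ 4|m|`, `T̲`.
[cite: Ellithy2026, Def. 4.4, p. 39] -/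
theorem schwarzschildStatic_hasUniformCollarControl (hr₀ : 0 < r₀) (hm : 4 * |m| ≤ r₀) (Tlo : ℝ) :
    HasUniformCollarControl 𝓘(ℝ, ℝ × E3) (M := ℝ × E3) (schwarzschildStaticForm m) minkPolarChart
      Tlo r₀ := by
  intro r₁ hr₁
  set ε : ℝ := r₀ / 4 with hε
  set U : Set E3 := {y : E3 | r₀ / 2 < ‖y‖} with hU
  have hUo : IsOpen U := isOpen_lt continuous_const continuous_norm
  have hG' : ContDiffOn ℝ 2 (schwarzschildStaticField m) U := contDiffOn_schwarzschildStaticField hr₀ hm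
  -- the compact closed collar `K = {r₀ - ε ≤ |y| ≤ r₁ + ε} ⊆ U`
  set K : Set E3 := {y : E3 | r₀ - ε ≤ ‖y‖ ∧ ‖y‖ ≤ r₁ + ε} with hK
  have hKU : K ⊆ U := fun y hy ↦ by
    simp only [hK, hU, mem_setOf_eq] at hy ⊢; linarith [hy.1]
  have hKc : IsCompact K := by
    refine (isCompact_closedBall (0 : E3) (r₁ + ε)).of_isClosed_subset ?_ fun y hy ↦ ?_
    · exact (isClosed_le continuous_const continuous_norm).inter
        (isClosed_le continuous_norm continuous_const)
    · rw [mem_closedBall, dist_zero_right]; exact hy.2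
  -- continuity of the derivatives on `U`, bounds on `K`
  have hcont : ∀ k ≤ 2, ContinuousOn (fun y ↦ iteratedFDeriv ℝ k (schwarzschildStaticField m) y) K := by
    intro k hk
    have h1 : ContinuousOn (iteratedFDerivWithin ℝ k (schwarzschildStaticField m) U) U :=
      hG'.continuousOn_iteratedFDerivWithin (by exact_mod_cast hk) hUo.uniqueDiffOn
    exact (h1.congr fun y hy ↦ (iteratedFDerivWithin_of_isOpen k hUo hy).symm).mono hKU
  have hbd : ∀ k ≤ 2, ∃ C, ∀ y ∈ K, ‖iteratedFDeriv ℝ k (schwarzschildStaticField m) y‖ ≤ C :=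
    fun k hk ↦ hKc.exists_bound_of_continuousOn (hcont k hk)
  obtain ⟨C₀, hC₀⟩ := hbd 0 (by norm_num)
  obtain ⟨C₁, hC₁⟩ := hbd 1 (by norm_num)
  obtain ⟨C₂, hC₂⟩ := hbd 2 le_rfl
  set C : ℝ := max C₀ (max C₁ C₂) with hC
  have hCk : ∀ k ≤ 2, ∀ y ∈ K, ‖iteratedFDeriv ℝ k (schwarzschildStaticField m) y‖ ≤ C := by
    intro k hk y hy
    interval_cases k
    · exact (hC₀ y hy).trans (le_max_left _ _)
    · exact (hC₁ y hy).trans (le_max_of_le_right (le_max_left _ _))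
    · exact (hC₂ y hy).trans (le_max_of_le_right (le_max_right _ _))
  -- the field on `ℝ × E3`
  set G : ℝ × E3 → (ℝ × E3) →L[ℝ] (ℝ × E3) →L[ℝ] ℝ := fun q ↦ schwarzschildStaticField m q.2 with hGdef
  have hGcomp : G = schwarzschildStaticField m ∘ (ContinuousLinearMap.snd ℝ ℝ E3) := rfl
  have hshellU : ∀ q ∈ lateShell Tlo (r₀ - ε) (r₁ + ε), q.2 ∈ U := fun q hq ↦ by
    simp only [hU, mem_setOf_eq]; have := hq.2.1; linarith
  have hshellK : ∀ q ∈ lateShell Tlo (r₀ - ε) (r₁ + ε), q.2 ∈ K := fun q hq ↦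
    ⟨hq.2.1.le, hq.2.2.le⟩
  refine ⟨Tlo, ε, C, 1 / 3, le_rfl, by positivity, by norm_num, G, ?_, ?_, ?_, ?_⟩
  · -- `C²` on the two-sided shell
    rw [hGcomp]
    exact hG'.comp (ContinuousLinearMap.snd ℝ ℝ E3).contDiff.contDiffOn fun q hq ↦ hshellU q hq
  · -- agreement with the chart metric on the late open exterior part of the shell
    intro q hq
    have hq2 : r₀ < ‖q.2‖ := hq.2.1
    have hq0 : q.2 ≠ 0 := norm_pos_iff.mp (hr₀.trans hq2)
    rw [chartMetric, pullbackBilin_minkPolarChart_of _ hq0, hGdef]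
    simp only
    rw [schwarzschildStaticField_eq hr₀ hm q.1 hq2]
  · -- uniform bounds on the derivatives up to order 2
    intro q hq k hk
    have hpre : (ContinuousLinearMap.snd ℝ ℝ E3) ⁻¹' U = {q : ℝ × E3 | q.2 ∈ U} := rfl
    have hpreo : IsOpen ((ContinuousLinearMap.snd ℝ ℝ E3) ⁻¹' U) := hUo.preimage continuous_snd
    have hqU : (ContinuousLinearMap.snd ℝ ℝ E3) q ∈ U := hshellU q hq
    have hqpre : q ∈ (ContinuousLinearMap.snd ℝ ℝ E3) ⁻¹' U := hqU
    have key := (ContinuousLinearMap.snd ℝ ℝ E3).iteratedFDerivWithin_comp_right (f := schwarzschildStaticField m)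
      (hG'.of_le (by exact_mod_cast hk : ((k : ℕ) : WithTop ℕ∞) ≤ 2)) hUo.uniqueDiffOn hpreo.uniqueDiffOn hqU
      (i := k) le_rfl
    rw [iteratedFDerivWithin_of_isOpen k hpreo hqpre, iteratedFDerivWithin_of_isOpen k hUo hqU] at key
    rw [hGcomp, key]
    refine (ContinuousMultilinearMap.norm_compContinuousLinearMap_le _ _).trans ?_
    have hsnd : ‖ContinuousLinearMap.snd ℝ ℝ E3‖ ≤ 1 :=
      ContinuousLinearMap.opNorm_le_bound _ zero_le_one fun v ↦ by simpa using norm_snd_le v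
    have hprod : ∏ _i : Fin k, ‖ContinuousLinearMap.snd ℝ ℝ E3‖ ≤ 1 :=
      Finset.prod_le_one (fun _ _ ↦ norm_nonneg _) fun _ _ ↦ hsnd
    have hCq := hCk k hk q.2 (hshellK q hq)
    have hC0 : 0 ≤ C := (norm_nonneg _).trans hCq
    calc ‖iteratedFDeriv ℝ k (schwarzschildStaticField m) ((ContinuousLinearMap.snd ℝ ℝ E3) q)‖ *
          ∏ _i : Fin k, ‖ContinuousLinearMap.snd ℝ ℝ E3‖
        ≤ C * 1 := mul_le_mul hCq hprod (Finset.prod_nonneg fun _ _ ↦ norm_nonneg _) hC0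
      _ = C := mul_one C
  · -- uniform nondegeneracy
    intro q hq v
    have hq2 : r₀ - ε < ‖q.2‖ := hq.2.1
    have hy0 : 0 < ‖q.2‖ := by linarith
    have hy3 : 3 * |m| ≤ ‖q.2‖ := by linarith
    exact norm_le_norm_schwarzschildStaticField hy0 hy3 v

/-- **The static Schwarzschild model inhabits the assembled predicate `IsQuasiFinalAnalyticCollar`**
(Def. 4.4 (1)+(2), §4.1 rest frame, and the collar sentence) for every `r₀ > 0`, `r₀ ≥ 4|m|`, `T̲` — the
positive-mass counterpart of `minkowski_isQuasiFinalAnalyticCollar`.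
[cite: Ellithy2026, Def. 4.4, p. 39; Remark 4.6, p. 40] -/
theorem schwarzschildStatic_isQuasiFinalAnalyticCollar (hr₀ : 0 < r₀) (hm : 4 * |m| ≤ r₀) (Tlo : ℝ) :
    IsQuasiFinalAnalyticCollar 𝓘(ℝ, ℝ × E3) (M := ℝ × E3) (schwarzschildStaticForm m) minkPolarChart
      Tlo r₀ :=
  ⟨schwarzschildStatic_isQuasiFinalAnalytic hr₀ hm Tlo, schwarzschildStatic_hasUniformCollarControl hr₀ hm Tlo⟩

end StaticCollar


end Literature.Geometry.Lorentzian.TailClassModel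

end
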